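import Summits.QuantumFields.BalabanUV.T4Continuum.Support.DirichletVertexCubes
import Summits.QuantumFields.BalabanUV.T4Continuum.Support.CoordOctantBoxes

/-!
# `BalabanUV.T4Continuum.Support.DirichletVertexCover` — NE2 (node U1a) formalisation swarm, sub-row `T4-U1a.S-NE2-D1-DIRICHLET°`, supplier item
# «Δ1-SKELETON» (file 15): (a) the local MASS near a vertex of an exterior block is controlled by the charted Dirichlet form of the vertex cube
# (gen 6's octant Poincaré `sum_norm_sq_cube_le` + vanishing on the exterior octant), (b) BOUNDED OVERLAP of gen 6's Morrey cubes
# `chart (cornerBase β′ K)` (`2K ≤ n`): every site lies in at most `2^d` of them, so a sum of local budgets over all vertices is at most `2^d` times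
# the global budget (unit b2b-balaban-t4-ne2-formalise-leaf-08, gen 7, file 15)

HONEST FRAMING.  Lattice geometry at MODEL level (finite torus `Tor (fine n M)`); [folklore]; NE2 (U1a) is NOT proved by this file; spine PROVED
0/9 unchanged; NOT infinite volume, NOT the mass gap, NOT Clay.  HONEST DEPENDENCY (verbatim): «continuum YM on T⁴ ⇐ BetaPertH ∧ nine spine
estimates (0/9 proved); BetaPertH ⇐ (D1) ∧ (D4) ∧ CAP+tail; G-an2-4 gates asym, D1 and NE2/3/4.»

WHAT THIS FILE PROVES (0 sorry).  `vtxBase_eq_cornerBase`, `sum_nearVtx_le_sum_chart_univ`, **`sum_nearVtx_normSq_le_dirOn`**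
(`Σ_{x : NearVtx r β′ x} ‖z x‖² ≤ (1+2^d)·(n₀(n₀+1)/2)·dirOn univ (z ∘ chart (vtxBase m K β′))` for `z` supported in `blockReg S`, `cornerBlock β′ σ ∉ S`),
`blockOf_chart_cornerBase_or` (the block of a charted site is `β′` or `β′ − 1` along each axis), **`sum_charts_le_two_pow_mul`**
(`Σ_{β′} Σ_j G(chart (cornerBase β′ K) j) ≤ 2^d·Σ_y G y` for `G ≥ 0`, `2K ≤ n`, `4K = nn + 1 ≤ n·M ν`).

ABSOLUTE RULE (cell, verbatim): «No internally-minted statement may enter as a cited fact. Every hypothesis is either kernel-proved in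
this package or a verbatim quotation of a PUBLISHED theorem with page reference. The manuscript(s) under audit are NOT citable for
their own disputed steps — they are the thing under adjudication; programme-internal (2001/route/tribunal) claims are never citable.»
[folklore]; no new definition; no `def … : Prop` fact.  NOT CLAIMED: any decay rate, NE2, NE3.
-/

noncomputable section

open scoped BigOperators ComplexConjugate Matrix
open Finset

namespace Summit.QuantumFields.BalabanUV.T4Continuum.DirichletVertexCover

open Literature.MathematicalPhysics.QuantumFieldTheory.Balaban1983to89.B5Prop11Plancherel (Tor fine unitVec)
open Literature.MathematicalPhysics.QuantumFieldTheory.Balaban1983to89.B5Block118 (bpt up upHom iota)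
open Literature.MathematicalPhysics.QuantumFieldTheory.Balaban1983to89.B5Blocks16 (blockOf blockOf_bpt)
open Summit.QuantumFields.BalabanUV.Beta.GAN24.DirichletBoxTrace (blockReg)
open Summit.QuantumFields.BalabanUV.T4Continuum.CoordSlabPoincare (dirOn)
open Summit.QuantumFields.BalabanUV.T4Continuum.CoordOctantBoxes (oct sum_norm_sq_cube_le)
open Summit.QuantumFields.BalabanUV.T4Continuum.DirichletHoleFillingCutoff (chart chart_injective)
open Summit.QuantumFields.BalabanUV.T4Continuum.DirichletMorreyDecay (shift)
open Summit.QuantumFields.BalabanUV.T4Continuum.DirichletMorreyDecayBlock (cornerBase cornerBlock vanish_oct_of_blockReg)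
open Summit.QuantumFields.BalabanUV.T4Continuum.DirichletVertexCubes
  (NearVtx vtxBase vtxIdx chart_vtxIdx upHom_one)

variable {d : ℕ} {n : ℕ} [NeZero n] {M : Fin d → ℕ} [hM : ∀ μ, NeZero (M μ)]

omit [NeZero n] in
/-- the cube fits into the torus as soon as its side is at most `n`. [folklore] -/
theorem fits {nn : ℕ} (h : nn + 1 ≤ n) (lam : Fin d) : nn + 1 ≤ fine n M lam := by
  have h1 : 1 ≤ M lam := Nat.one_le_iff_ne_zero.mpr (NeZero.ne _)
  have : n ≤ fine n M lam := by unfold fine; exact Nat.le_mul_of_pos_right n h1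
  omega

/-! ## (a) the local mass near a vertex of an exterior block -/

omit [NeZero n] hM in
/-- the vertex cube of side `4m` IS gen 6's corner cube at scale `m`: `vtxBase m K β′ = cornerBase β′ m` (`m ≤ K`). [folklore] -/
theorem vtxBase_eq_cornerBase {m K : ℕ} (hmK : m ≤ K) (β' : Tor M) : vtxBase n M m K β' = cornerBase n M β' m := by
  funext ν
  simp only [vtxBase, shift, cornerBase, Pi.add_apply, Pi.sub_apply]
  have h2 : 2 * m ≤ 2 * K := by omega
  push_cast [Nat.cast_sub h2]
  ring

/-- reindexing over the WHOLE cube: `Σ_{x : NearVtx r β′ x} G x ≤ Σ_j G (chart (vtxBase m K β′) j)` for `G ≥ 0`. [folklore] -/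
theorem sum_nearVtx_le_sum_chart_univ {m K : ℕ} (hmK : m ≤ K) (h4m : 4 * m ≤ n) {n₀ : ℕ} (hn₀ : 4 * m = n₀ + 1) {r : ℕ} (hr : r ≤ 2 * m)
    (β' : Tor M) [DecidablePred (NearVtx n M r β')] {G : Tor (fine n M) → ℝ} (hG : ∀ x, 0 ≤ G x) :
    ∑ x, (if NearVtx n M r β' x then G x else 0) ≤ ∑ j : Fin d → Fin (n₀ + 1), G (chart (fine n M) (vtxBase n M m K β') j) := by
  classical
  have hN' : ∀ lam, n₀ + 1 ≤ fine n M lam := fits (by omega)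
  rw [← Finset.sum_filter]
  rw [← Finset.sum_image (f := fun x => G x) (s := (univ : Finset (Fin d → Fin (n₀ + 1))))
    (fun j _ j' _ h => chart_injective (fine n M) _ hN' h)]
  refine Finset.sum_le_sum_of_subset_of_nonneg ?_ fun x _ _ => hG x
  intro x hx
  rw [mem_filter] at hx
  exact mem_image.mpr ⟨vtxIdx n M m hn₀ x, mem_univ _, chart_vtxIdx hmK h4m hn₀ hr hx.2⟩

/-- **LOCAL MASS ≤ CHARTED DIRICHLET FORM.**  `z` supported in `blockReg S`, `cornerBlock β′ σ ∉ S`, `r ≤ 2m`, `m ≤ K`, `4m = n₀ + 1 ≤ n`: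
`Σ_{x : NearVtx r β′ x} ‖z x‖² ≤ (1 + 2^d)·(n₀(n₀+1)/2)·dirOn univ (z ∘ chart (vtxBase m K β′))`. [folklore] -/
theorem sum_nearVtx_normSq_le_dirOn {m K : ℕ} (hmK : m ≤ K) (h4m : 4 * m ≤ n) {n₀ : ℕ} (hn₀ : 4 * m = n₀ + 1) {r : ℕ} (hr : r ≤ 2 * m)
    (S : Tor M → Prop) [DecidablePred S] {z : Tor (fine n M) → ℂ} (hz : ∀ x, ¬ blockReg n M S x → z x = 0)
    (β' : Tor M) [DecidablePred (NearVtx n M r β')] (σ : Fin d → Bool) (hβ : ¬ S (cornerBlock M β' σ)) :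
    ∑ x, (if NearVtx n M r β' x then ‖z x‖ ^ 2 else 0)
      ≤ (1 + 2 ^ d) * ((n₀ : ℝ) * (n₀ + 1) / 2)
          * dirOn (univ : Finset (Fin d → Fin (n₀ + 1))) (z ∘ chart (fine n M) (n := n₀) (vtxBase n M m K β')) := by
  refine (sum_nearVtx_le_sum_chart_univ hmK h4m hn₀ hr β' (G := fun x => ‖z x‖ ^ 2) (fun _ => sq_nonneg _)).trans ?_
  have hF : ∀ j ∈ oct (n := n₀) m σ, (z ∘ chart (fine n M) (n := n₀) (vtxBase n M m K β')) j = 0 := by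
    intro j hj
    rw [Function.comp_apply, vtxBase_eq_cornerBase hmK]
    exact vanish_oct_of_blockReg n M S hz β' σ hβ (by omega) hn₀ j hj
  exact sum_norm_sq_cube_le hn₀ σ _ hF

/-! ## (b) bounded overlap of the Morrey cubes -/

/-- the block of a charted site: along every axis it is `β′ ν` (upper half of the cube) or `β′ ν − 1` (lower half). [folklore] -/
theorem blockOf_chart_cornerBase_or {K : ℕ} (hK : 2 * K ≤ n) {nn : ℕ} (hnn : 4 * K = nn + 1) (β' : Tor M) (j : Fin d → Fin (nn + 1))
    (ν : Fin d) :
    β' ν = blockOf n M (chart (fine n M) (cornerBase n M β' K) j) ν ∨ β' ν = blockOf n M (chart (fine n M) (cornerBase n M β' K) j) ν + 1 := by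
  -- the explicit (block, offset) representation of the charted site
  set b'' : Tor M := fun lam => if 2 * K ≤ (j lam : ℕ) then β' lam else β' lam - 1 with hb''
  have hjlt : ∀ lam, (j lam : ℕ) < nn + 1 := fun lam => (j lam).isLt
  set j'' : Fin d → Fin n := fun lam =>
    ⟨if 2 * K ≤ (j lam : ℕ) then (j lam : ℕ) - 2 * K else (j lam : ℕ) + n - 2 * K, by
      have := hjlt lam; split_ifs <;> omega⟩ with hj''
  have hrep : bpt n M b'' j'' = chart (fine n M) (cornerBase n M β' K) j := by
    funext lam
    simp only [bpt, up, iota, chart, cornerBase, Pi.add_apply, Pi.sub_apply, hb'', hj'']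
    by_cases h : 2 * K ≤ (j lam : ℕ)
    · rw [if_pos h, if_pos h]
      push_cast [Nat.cast_sub h]
      ring
    · rw [if_neg h, if_neg h, map_sub, upHom_one]
      have h3 : 2 * K ≤ (j lam : ℕ) + n := by omega
      push_cast [Nat.cast_sub h3]
      ring
  rw [← hrep, blockOf_bpt]
  by_cases h : 2 * K ≤ (j ν : ℕ)
  · left; simp only [hb'', if_pos h]
  · right; simp only [hb'', if_neg h, sub_add_cancel]

/-- **BOUNDED OVERLAP**: `Σ_{β′} Σ_j G(chart (cornerBase β′ K) j) ≤ 2^d·Σ_y G y` for `G ≥ 0` (`2K ≤ n`, `4K = nn + 1 ≤ n·M ν`). [folklore] -/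
theorem sum_charts_le_two_pow_mul {K : ℕ} (hK : 2 * K ≤ n) {nn : ℕ} (hnn : 4 * K = nn + 1) (hN' : ∀ ν, nn + 1 ≤ fine n M ν)
    {G : Tor (fine n M) → ℝ} (hG : ∀ x, 0 ≤ G x) :
    ∑ β' : Tor M, ∑ j : Fin d → Fin (nn + 1), G (chart (fine n M) (cornerBase n M β' K) j) ≤ 2 ^ d * ∑ y, G y := by
  classical
  -- each inner sum is the sum over the image (injective chart)
  have himg : ∀ β' : Tor M, ∑ j : Fin d → Fin (nn + 1), G (chart (fine n M) (cornerBase n M β' K) j)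
      = ∑ y, (if y ∈ (univ : Finset (Fin d → Fin (nn + 1))).image (chart (fine n M) (cornerBase n M β' K)) then G y else 0) := by
    intro β'
    rw [← Finset.sum_filter, Finset.filter_mem_eq_inter, Finset.univ_inter,
      Finset.sum_image (fun j _ j' _ h => chart_injective (fine n M) _ hN' h)]
  simp_rw [himg]
  rw [Finset.sum_comm, Finset.mul_sum]
  refine Finset.sum_le_sum fun y _ => ?_
  -- the multiplicity of `y`
  set T : Finset (Tor M) := Fintype.piFinset fun ν => ({blockOf n M y ν, blockOf n M y ν + 1} : Finset (ZMod (M ν))) with hT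
  have hsub : (univ.filter fun β' : Tor M => y ∈ (univ : Finset (Fin d → Fin (nn + 1))).image (chart (fine n M) (cornerBase n M β' K))) ⊆ T := by
    intro β' hβ'
    rw [mem_filter] at hβ'
    obtain ⟨j, -, hj⟩ := mem_image.mp hβ'.2
    rw [hT, Fintype.mem_piFinset]
    intro ν
    rw [← hj]
    rcases blockOf_chart_cornerBase_or hK hnn β' j ν with h | h
    · rw [mem_insert]; exact Or.inl h
    · rw [mem_insert, mem_singleton]; exact Or.inr h
  have hcard : (T.card : ℝ) ≤ 2 ^ d := by
    rw [hT, Fintype.card_piFinset]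
    have : ∏ ν : Fin d, (({blockOf n M y ν, blockOf n M y ν + 1} : Finset (ZMod (M ν))).card) ≤ ∏ _ν : Fin d, 2 :=
      Finset.prod_le_prod' fun ν _ => Finset.card_le_two
    rw [Finset.prod_const, Finset.card_univ, Fintype.card_fin] at this
    exact_mod_cast this
  calc ∑ β' : Tor M, (if y ∈ (univ : Finset (Fin d → Fin (nn + 1))).image (chart (fine n M) (cornerBase n M β' K)) then G y else 0)
      = ((univ.filter fun β' : Tor M =>
          y ∈ (univ : Finset (Fin d → Fin (nn + 1))).image (chart (fine n M) (cornerBase n M β' K))).card : ℝ) * G y := by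
        rw [← Finset.sum_filter, Finset.sum_const, nsmul_eq_mul]
    _ ≤ (T.card : ℝ) * G y := by
        exact mul_le_mul_of_nonneg_right (by exact_mod_cast Finset.card_le_card hsub) (hG y)
    _ ≤ 2 ^ d * G y := mul_le_mul_of_nonneg_right hcard (hG y)

end Summit.QuantumFields.BalabanUV.T4Continuum.DirichletVertexCover

end
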